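import Literature.MathematicalPhysics.QuantumFieldTheory.Balaban1983to89.Node00.TwoRunSitePeierlsCoverFamily
import Literature.MathematicalPhysics.QuantumFieldTheory.Balaban1983to89.B13BondAveragingReadingNumerals
import Literature.MathematicalPhysics.QuantumFieldTheory.Balaban1983to89.T4UndoubledRP
import Literature.MathematicalPhysics.QuantumFieldTheory.Balaban1983to89.B15Prop1DatumSmall7AtZSequence
import Literature.MathematicalPhysics.QuantumFieldTheory.Balaban1983to89.B3Taylor310LocalRemainder
import Summits.QuantumFields.YangMills.Theorems.FluctuationComparisonRegPrIntLPolymerPinAlgebra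
import Mathlib.Combinatorics.SimpleGraph.Paths
import HarnessLib

/-!
# LFG^{can}∘ SOCKET LETTERS (G6): THE FOOTPRINT GEOMETRY OF THE 𝐑-OPERATION'S POLYMERS — BIG-BLOCK CELLS `B^μ(y)` (Bałaban's `M`-cubes, `M = L^μ`), THE TOUCHING GRAPH
# OF BLOCKS (degree `≤ 3^d − 1`), AND «two fine sites under a touching-connected family of `n` blocks are within `2d·L^μ·n`» — the binders `C H Δ cell m s₀ size ℓ ℓ₀ hm hs₀ hℓ0
# hdiam hℓ` of ✓`…LargeFieldGasKnitAE.canIntBody_of_factorised_histories`, DISCHARGED for every grain `μ`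

Cell `ym3-torus` (HUMAN RULING D-0037: rung R3 = continuum `SU(2)` Yang–Mills on `T³` — NOT `d = 4`, NOT infinite volume, NOT a mass gap, NOT the Clay problem); width seat
`ym3-torus-px10` (gen 17), continuing the px10 LFG lineage (gen 16: ✓`…LargeFieldGasCanonicalCurrency` ∕ `…InteriorDoor` ∕ `…WindowCut` ∕ `…CanonicalTransfer` ∕ `…Budget` ∕
`…BudgetSmall`); helper of the crux `stmt-QuantumFields-20520` `UnitScaleTilt.FluctuationComparisonRegPrIntL` (`--supports … --as helper`, NOT a proof of it); answers the
successor brief `LOCATE-R1-DEPTH1-r3p1g0.md` §1 «CELLS» of ymfull-r3-prover-1 g0.  THEOREMS ONLY: 0 `def`, 0 `instance`, 0 `notation`, 0 `sorry`, default heartbeats.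

WHY BIG BLOCKS.  The socket's Kotecký–Preiss rate row reads `Ψ J·s₀ + κ·ℓ₀ + log m + 2 log Δ + Ψ J + 2 ≤ κμ`, `κμ` being the engine's tree decay PER CELL
(`|ζ(Q′, X)| ≤ (Π sf)·e^{−κμ·size X}`).  Print supplies decay `E₀e^{−κ d(X)}` with `κ = O(1)` ([Balaban1987RG1] (0.25), [Balaban1989LargeFieldII] (1.100)) and beats the
`(3^d − 1)²`-per-cell entropy only because its localisation domains are unions of `M`-cubes with `M` LARGE (decay per cube `≈ κM`).  So the cells of the socket must be the
`μ`-fold blocks `B^μ(y)`, `y ∈ Site P μ` (✓`B5Eq118OneStroke.iterBlock`), with `μ` a free parameter of the engine (`μ = 0` = unit cubes).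
* §1 CELLS: `cell y := {b : PBond P 0 | iterBlockOf μ b.src = y}` — every fine bond in exactly one cell (`m = 1`, `card_filter_mem_cell_le_one`), `≤ d·L^{dμ}` bonds per cell
  (`s₀`, `card_cell_le`, ✓`card_iterBlock`), `mem_biUnion_cell_iff`, `image_blk_biUnion_cell` (the footprint remembers its blocks, via the block centres ✓`embIter_mem_iterBlock'`),
  so `size X := |blocks of X|` recovers `|Fc|` (`card_image_blk_biUnion_cell`).
* §2 DISTANCES: `scaleTo_apply_of_eq_natCast` (the fine vector of a coarse translation, coordinatewise: ✓`T4Covariance.Site.scaleTo`, ✓`T4UndoubledRP.scaleCoord_natCast`),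
  ✓`B15Prop1DatumSmall7AtZSequence.embIter_add` (block centres intertwine translations), ★`tdist_embIter_le_of_siteTouch` (centres of TOUCHING blocks are within `d·L^μ` — incl. the
  wrap-around of the torus), ★`tdist_embIter_le_of_induce_connected` (centres of a touching-connected family of `n` blocks are within `d·L^μ·(n − 1)`, Mathlib `Walk.toPath` +
  `IsPath.length_lt`), ★★`tdist_le_of_blocks_connected` (any two fine sites under the family: `≤ 2d(L^μ − 1) + dL^μ(n − 1) ≤ 2dL^μ·n`, within-block legs by
  ✓`B13BondAveragingReadingNumerals.tdist_le_of_mem_iterBlock₂`).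
* §3 THE LETTERS: `ℓ X :=` the source-`tdist` diameter (the SAME length as the sibling GAS road's ✓`KPGasOfGeometricActivities.kpGasOn_of_geometric`), `hdiam`
  (✓`…PolymerPinAlgebra.cast_dist_le_cast_supDiam`), ★`supDiam_le_of_adm` (= the socket's `hℓ` with `ℓ₀ := 2d·L^μ` for ANY admissibility predicate whose footprints are unions of
  the cells of a touching-connected family of blocks), `hΔ` (✓`Node00.degree_touchingGraph_siteTouch_le_pred`, `Δ = 3^d − 1 = 26`), ★★`footprint_letters` (all rows bundled).

HONEST (CREDITS NOTHING): finite torus combinatorics; the engine rows of the socket (the factorised small-field expansion with holes — Bałaban's 𝐑-operation, [Balaban1985UV3]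
(43)–(47), (67)–(71); [Balaban1989LargeFieldII] (1.84)–(1.101)) are untouched; LFG^{can}∘ ∕ `stub_largeFieldFourPtIntCan` ∕ S2β ∕ the crux 20520 NOT proved; `YM3TorusSU2` NOT
proved; the Yang–Mills mass gap (Clay) NOT proved; rung R3 = YM₃ on `T³` — NOT `d = 4`, NOT infinite volume, NOT a mass gap.
References: [Balaban1989LargeFieldII] T. Bałaban, CMP 122 (1989): (1.84) p.386 (components of unions of big cubes), (1.97)–(1.100) pp.389–390 (tree decay per cube);
[Balaban1987RG1] CMP 109 (1987): (0.1) p.251 (the lattice of centres), (0.22)–(0.25) pp.256–257 (localisation domains = unions of `M`-cubes, `E₀e^{−κd(X)}`); [Balaban1985UV3]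
CMP 102 (1985): (39) p.266 (`R(g_k)M₁` cubes).
-/

set_option autoImplicit false

noncomputable section

open Finset
open scoped BigOperators
open Literature.MathematicalPhysics.QuantumFieldTheory.Balaban1983to89
open Literature.MathematicalPhysics.QuantumFieldTheory.Balaban1983to89.Node00 (touchingGraph touchingGraph_adj SiteTouch SiteTouch.symm
  degree_touchingGraph_siteTouch_le_pred)
open Literature.MathematicalPhysics.QuantumFieldTheory.Balaban1983to89.B5Eq118OneStroke (iterBlockOf iterBlock mem_iterBlock mem_iterBlock_iff card_iterBlock)
open Literature.MathematicalPhysics.QuantumFieldTheory.Balaban1983to89.B15DeterminingSets (embIter)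
open Literature.MathematicalPhysics.QuantumFieldTheory.Balaban1983to89.B13BondAveragingReadingNumerals (embIter_mem_iterBlock' tdist_le_of_mem_iterBlock₂)

namespace Summit.QuantumFields.YangMills.Theorems.FluctuationComparisonRegPrIntLLargeFieldGasFootprint

variable {P : Params} {μ : ℕ}

/-! ## §1 Big-block cells on the fine bonds of a torus -/

open Classical in
/-- Every fine bond lies in exactly one block cell (so `m = 1`): the cells containing `e` are `⊆ {B^μ(e.src)}`. [cite: Balaban1987RG1, (0.1) p.251 (bookkeeping)] -/
theorem card_filter_mem_cell_le_one (e : PBond P 0) :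
    (Finset.univ.filter fun y : Site P μ => e ∈ Finset.univ.filter (fun b : PBond P 0 => iterBlockOf μ b.src = y)).card ≤ 1 := by
  have h : (Finset.univ.filter fun y : Site P μ => e ∈ Finset.univ.filter (fun b : PBond P 0 => iterBlockOf μ b.src = y)) ⊆ {iterBlockOf μ e.src} := by
    intro y hy
    simp only [Finset.mem_filter, Finset.mem_univ, true_and] at hy
    exact Finset.mem_singleton.mpr hy.symm
  exact (Finset.card_le_card h).trans (by simp)

open Classical in
/-- A block cell has at most `d·L^{dμ}` bonds (so `s₀ = d·L^{dμ}`): a bond of the cell is (its source in `B^μ(y)`, its direction); `|B^μ(y)| = L^{dμ}` (✓`card_iterBlock`, standing range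
`μ ≤ m + K`). [cite: Balaban1984PropagatorsI, (1.18) p.20 (bookkeeping)] -/
theorem card_cell_le (hμ : μ ≤ P.m + P.K) (y : Site P μ) :
    (Finset.univ.filter fun b : PBond P 0 => iterBlockOf μ b.src = y).card ≤ P.d * (P.L ^ P.d) ^ μ := by
  have hmap : ∀ b ∈ Finset.univ.filter (fun b : PBond P 0 => iterBlockOf μ b.src = y),
      (fun b : PBond P 0 => (b.src, b.dir)) b ∈ iterBlock μ y ×ˢ (Finset.univ : Finset (Fin P.d)) := by
    intro b hb
    simp only [Finset.mem_filter, Finset.mem_univ, true_and] at hb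
    simp [mem_iterBlock, hb]
  have hinj : Set.InjOn (fun b : PBond P 0 => (b.src, b.dir)) ↑(Finset.univ.filter fun b : PBond P 0 => iterBlockOf μ b.src = y) := by
    intro b _ b' _ h
    simp only [Prod.mk.injEq] at h
    cases b; cases b'
    simp only at h
    obtain ⟨h1, h2⟩ := h
    subst h1; subst h2; rfl
  calc (Finset.univ.filter fun b : PBond P 0 => iterBlockOf μ b.src = y).card
      ≤ (iterBlock μ y ×ˢ (Finset.univ : Finset (Fin P.d))).card := Finset.card_le_card_of_injOn _ hmap hinj
    _ = P.d * (P.L ^ P.d) ^ μ := by rw [Finset.card_product, card_iterBlock μ hμ y]; simp [mul_comm]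

open Classical in
/-- Membership in a footprint: `b ∈ ⋃_{y ∈ Fc} cell y ↔ B^μ(b.src) ∈ Fc`. [cite: Balaban1989LargeFieldII, (1.84) p.386 (bookkeeping)] -/
theorem mem_biUnion_cell_iff (Fc : Finset (Site P μ)) (b : PBond P 0) :
    b ∈ Fc.biUnion (fun y => Finset.univ.filter (fun b : PBond P 0 => iterBlockOf μ b.src = y)) ↔ iterBlockOf μ b.src ∈ Fc := by
  simp only [Finset.mem_biUnion, Finset.mem_filter, Finset.mem_univ, true_and]
  exact ⟨fun ⟨y, hy, hb⟩ => hb ▸ hy, fun h => ⟨iterBlockOf μ b.src, h, rfl⟩⟩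

/-- The block centre lies over its block: `iterBlockOf μ (embIter μ y) = y` (✓`embIter_mem_iterBlock'`). [cite: Balaban1987RG1, (0.1) p.251 (bookkeeping)] -/
theorem iterBlockOf_embIter (hμ : μ ≤ P.m + P.K) (y : Site P μ) : iterBlockOf μ (embIter μ y) = y :=
  (mem_iterBlock μ y _).mp (embIter_mem_iterBlock' hμ y)

open Classical in
/-- The footprint of a family of blocks remembers the family (`d ≥ 1`: the centre of each block issues a bond): `(⋃_{y ∈ Fc} cell y).image (B^μ ∘ src) = Fc` — so
`size X := |blocks of X|` is the number of blocks. [cite: Balaban1989LargeFieldII, (1.84) p.386 (bookkeeping)] -/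
theorem image_blk_biUnion_cell (hd : 0 < P.d) (hμ : μ ≤ P.m + P.K) (Fc : Finset (Site P μ)) :
    (Fc.biUnion (fun y => Finset.univ.filter (fun b : PBond P 0 => iterBlockOf μ b.src = y))).image (fun b : PBond P 0 => iterBlockOf μ b.src) = Fc := by
  ext y
  simp only [Finset.mem_image, mem_biUnion_cell_iff]
  refine ⟨fun ⟨b, hb, hby⟩ => hby ▸ hb, fun hy => ⟨⟨embIter μ y, ⟨0, hd⟩⟩, ?_, ?_⟩⟩
  · show iterBlockOf μ (embIter μ y) ∈ Fc
    rw [iterBlockOf_embIter hμ]; exact hy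
  · exact iterBlockOf_embIter hμ y

open Classical in
/-- `size (⋃_{y ∈ Fc} cell y) = |Fc|` with `size X := (X.image (B^μ ∘ src)).card`. [cite: Balaban1989LargeFieldII, (1.84) p.386 (bookkeeping)] -/
theorem card_image_blk_biUnion_cell (hd : 0 < P.d) (hμ : μ ≤ P.m + P.K) (Fc : Finset (Site P μ)) :
    ((Fc.biUnion (fun y => Finset.univ.filter (fun b : PBond P 0 => iterBlockOf μ b.src = y))).image (fun b : PBond P 0 => iterBlockOf μ b.src)).card = Fc.card := by
  rw [image_blk_biUnion_cell hd hμ]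

/-! ## §2 Touching blocks have close centres; connected families of blocks have small fine diameter -/

/-- **THE FINE VECTOR OF A COARSE TRANSLATION, COORDINATEWISE**: if the `ν`-coordinate of `a ∈ T^{(k)}` is the residue of `n`, the `ν`-coordinate of `scaleTo k a ∈ T^{(0)}` is the
residue of `n·L^k`. [cite: Balaban1987RG1, (0.1) p.251 (bookkeeping)] -/
theorem scaleTo_apply_of_eq_natCast : ∀ (k : ℕ) (a : Site P k) (ν : Fin P.d) (n : ℕ), a ν = (n : ZMod (P.sitesPerDir k)) →
    Site.scaleTo k a ν = ((n * P.L ^ k : ℕ) : ZMod (P.sitesPerDir 0))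
  | 0, a, ν, n, h => by rw [Site.scaleTo_zero, h, pow_zero, mul_one]
  | k + 1, a, ν, n, h => by
    rw [Site.scaleTo_succ]
    have h1 : Site.scale a ν = ((n * P.L : ℕ) : ZMod (P.sitesPerDir k)) := by
      rw [Site.scale_apply, h, T4UndoubledRP.scaleCoord_natCast]
    rw [scaleTo_apply_of_eq_natCast k (Site.scale a) ν (n * P.L) h1, pow_succ]
    congr 1
    ring

/-- The same for a negated residue: `a ν = −n ⇒ (scaleTo k a) ν = −(n·L^k)`. [cite: Balaban1987RG1, (0.1) p.251 (bookkeeping)] -/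
theorem scaleTo_apply_of_eq_neg_natCast (k : ℕ) (a : Site P k) (ν : Fin P.d) (n : ℕ) (h : a ν = -(n : ZMod (P.sitesPerDir k))) :
    Site.scaleTo k a ν = -((n * P.L ^ k : ℕ) : ZMod (P.sitesPerDir 0)) := by
  have hneg : (-a) ν = (n : ZMod (P.sitesPerDir k)) := by
    show -(a ν) = _
    rw [h, neg_neg]
  have h1 := scaleTo_apply_of_eq_natCast k (-a) ν n hneg
  rw [map_neg] at h1
  have h2 : (-(Site.scaleTo k a)) ν = -(Site.scaleTo k a ν) := rfl
  rw [h2] at h1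
  rw [← neg_neg (Site.scaleTo k a ν), h1]

/-- kernel: the residue of `q` has value `≤ q`. [folklore] -/
private theorem val_natCast_le {n : ℕ} [NeZero n] (q : ℕ) : ((q : ZMod n)).val ≤ q := by
  rw [ZMod.val_natCast]; exact Nat.mod_le q n

/-- ★ **CENTRES OF TOUCHING BLOCKS ARE WITHIN `d·L^k`** (`ℓ¹` torus distance of the fine lattice; the wrap-around of the torus is automatic: the fine vector of the coarse
translation `y′ − y ∈ {0, ±1}^d` is `L^k·(y′ − y)`). [cite: Balaban1989LargeFieldII, (1.84) p.386 (bookkeeping)] -/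
theorem tdist_embIter_le_of_siteTouch (k : ℕ) {y y' : Site P k} (h : SiteTouch y y') :
    Site.tdist (embIter k y) (embIter k y') ≤ P.d * P.L ^ k := by
  have hy' : y' = y + (y' - y) := by abel
  have he : embIter k y' = embIter k y + Site.scaleTo k (y' - y) := by
    conv_lhs => rw [hy']
    exact B15Prop1DatumSmall7AtZSequence.embIter_add k y (y' - y)
  unfold Site.tdist
  have hν : ∀ ν : Fin P.d, min (embIter k y ν - embIter k y' ν).val (embIter k y' ν - embIter k y ν).val ≤ P.L ^ k := by
    intro ν
    have heν : embIter k y' ν = embIter k y ν + Site.scaleTo k (y' - y) ν := by rw [he]; rfl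
    have hsub : (y' - y) ν = y' ν - y ν := rfl
    rcases h ν with h0 | h1 | h2
    · have hs : Site.scaleTo k (y' - y) ν = ((0 * P.L ^ k : ℕ) : ZMod (P.sitesPerDir 0)) :=
        scaleTo_apply_of_eq_natCast k _ ν 0 (by rw [hsub, h0, Nat.cast_zero])
      rw [heν, hs, zero_mul, Nat.cast_zero, add_zero, sub_self, ZMod.val_zero]
      exact (min_le_left _ _).trans (Nat.zero_le _)
    · have hs : Site.scaleTo k (y' - y) ν = ((1 * P.L ^ k : ℕ) : ZMod (P.sitesPerDir 0)) :=
        scaleTo_apply_of_eq_natCast k _ ν 1 (by rw [hsub, h1, Nat.cast_one])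
      rw [one_mul] at hs
      refine (min_le_right _ _).trans ?_
      rw [heν, hs, add_sub_cancel_left]
      exact val_natCast_le _
    · have hs : Site.scaleTo k (y' - y) ν = -((1 * P.L ^ k : ℕ) : ZMod (P.sitesPerDir 0)) :=
        scaleTo_apply_of_eq_neg_natCast k _ ν 1 (by rw [hsub, h2, Nat.cast_one])
      rw [one_mul] at hs
      refine (min_le_left _ _).trans ?_
      rw [heν, hs, ← sub_sub, sub_self, zero_sub, neg_neg]
      exact val_natCast_le _
  calc ∑ ν : Fin P.d, min (embIter k y ν - embIter k y' ν).val (embIter k y' ν - embIter k y ν).val ≤ ∑ _ν : Fin P.d, P.L ^ k :=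
        Finset.sum_le_sum fun ν _ => hν ν
    _ = P.d * P.L ^ k := by simp

/-- Centres of blocks ADJACENT in the touching graph are within `d·L^k`. [cite: Balaban1989LargeFieldII, (1.84) p.386 (bookkeeping)] -/
theorem tdist_embIter_le_of_adj (k : ℕ) {y y' : Site P k} (h : (touchingGraph (SiteTouch (P := P) (j := k))).Adj y y') :
    Site.tdist (embIter k y) (embIter k y') ≤ P.d * P.L ^ k := by
  rw [touchingGraph_adj] at h
  rcases h.2 with h1 | h1
  · exact tdist_embIter_le_of_siteTouch k h1
  · rw [B3Taylor310LocalRemainder.tdist_comm]; exact tdist_embIter_le_of_siteTouch k h1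

/-- ★ **CENTRES OF A TOUCHING-CONNECTED FAMILY OF `n` BLOCKS ARE WITHIN `d·L^k·(n − 1)`**: a shortest touching chain inside the family is a simple path of the induced graph, of
length `< n`, and each step moves the centre by `≤ d·L^k`. [cite: Balaban1989LargeFieldII, (1.84) p.386 and (1.100) p.390 (bookkeeping)] -/
theorem tdist_embIter_le_of_induce_connected (k : ℕ) (Fc : Finset (Site P k))
    (hc : ((touchingGraph (SiteTouch (P := P) (j := k))).induce (Fc : Set (Site P k))).Connected)
    {y y' : Site P k} (hy : y ∈ Fc) (hy' : y' ∈ Fc) : Site.tdist (embIter k y) (embIter k y') ≤ P.d * P.L ^ k * (Fc.card - 1) := by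
  classical
  set Gr := (touchingGraph (SiteTouch (P := P) (j := k))).induce (Fc : Set (Site P k)) with hGr
  -- every walk of length `n` in the induced graph joins centres within `d·L^k·n`
  have hwalk : ∀ (a b : ↥(Fc : Set (Site P k))) (p : Gr.Walk a b),
      Site.tdist (embIter k (a : Site P k)) (embIter k (b : Site P k)) ≤ P.d * P.L ^ k * p.length := by
    intro a b p
    induction p with
    | nil => simp [B3Taylor310LocalRemainder.tdist_self]
    | @cons u v w hadj p ih =>
      have huv : Site.tdist (embIter k (u : Site P k)) (embIter k (v : Site P k)) ≤ P.d * P.L ^ k := by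
        have h1 : (touchingGraph (SiteTouch (P := P) (j := k))).Adj (u : Site P k) (v : Site P k) := by
          rw [hGr, SimpleGraph.induce_adj] at hadj
          exact hadj
        exact tdist_embIter_le_of_adj k h1
      calc Site.tdist (embIter k (u : Site P k)) (embIter k (w : Site P k))
          ≤ Site.tdist (embIter k (u : Site P k)) (embIter k (v : Site P k)) + Site.tdist (embIter k (v : Site P k)) (embIter k (w : Site P k)) :=
            B3Taylor310LocalRemainder.tdist_triangle _ _ _
        _ ≤ P.d * P.L ^ k + P.d * P.L ^ k * p.length := Nat.add_le_add huv ih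
        _ = P.d * P.L ^ k * (SimpleGraph.Walk.cons hadj p).length := by rw [SimpleGraph.Walk.length_cons]; ring
  obtain ⟨p⟩ := hc.preconnected ⟨y, hy⟩ ⟨y', hy'⟩
  have hp := hwalk _ _ (p.toPath : Gr.Walk ⟨y, hy⟩ ⟨y', hy'⟩)
  have hlen : (p.toPath : Gr.Walk ⟨y, hy⟩ ⟨y', hy'⟩).length < Fc.card := by
    have h1 := SimpleGraph.Walk.IsPath.length_lt p.toPath.2
    have h2 : Fintype.card ↥((Fc : Set (Site P k))) = Fc.card := by simp
    omega
  calc Site.tdist (embIter k y) (embIter k y') ≤ P.d * P.L ^ k * (p.toPath : Gr.Walk ⟨y, hy⟩ ⟨y', hy'⟩).length := hp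
    _ ≤ P.d * P.L ^ k * (Fc.card - 1) := Nat.mul_le_mul_left _ (by omega)

/-- ★★ **TWO FINE SITES UNDER A TOUCHING-CONNECTED FAMILY OF `n` BLOCKS ARE WITHIN `2d·L^k·n`**: `z → centre(B^k(z)) → centre(B^k(z′)) → z′`, legs `≤ d(L^k − 1)`
(✓`tdist_le_of_mem_iterBlock₂`) and `≤ d·L^k·(n − 1)`; `2d(L^k − 1) + dL^k(n − 1) ≤ 2dL^k·n`. [cite: Balaban1989LargeFieldII, (1.84) p.386 and (1.100) p.390 (bookkeeping)] -/
theorem tdist_le_of_blocks_connected {k : ℕ} (hk : k ≤ P.m + P.K) (Fc : Finset (Site P k))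
    (hc : ((touchingGraph (SiteTouch (P := P) (j := k))).induce (Fc : Set (Site P k))).Connected)
    {z z' : Site P 0} (hz : iterBlockOf k z ∈ Fc) (hz' : iterBlockOf k z' ∈ Fc) : Site.tdist z z' ≤ 2 * P.d * P.L ^ k * Fc.card := by
  have hq : 1 ≤ P.L ^ k := Nat.one_le_pow _ _ P.L_pos
  have hn : 1 ≤ Fc.card := Finset.card_pos.mpr ⟨_, hz⟩
  have h1 : Site.tdist z (embIter k (iterBlockOf k z)) ≤ P.d * (P.L ^ k - 1) :=
    tdist_le_of_mem_iterBlock₂ hk ((mem_iterBlock k _ z).mpr rfl) (embIter_mem_iterBlock' hk _)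
  have h2 : Site.tdist (embIter k (iterBlockOf k z')) z' ≤ P.d * (P.L ^ k - 1) :=
    tdist_le_of_mem_iterBlock₂ hk (embIter_mem_iterBlock' hk _) ((mem_iterBlock k _ z').mpr rfl)
  have h3 := tdist_embIter_le_of_induce_connected k Fc hc hz hz'
  have htri : Site.tdist z z' ≤ Site.tdist z (embIter k (iterBlockOf k z)) +
      (Site.tdist (embIter k (iterBlockOf k z)) (embIter k (iterBlockOf k z')) + Site.tdist (embIter k (iterBlockOf k z')) z') :=
    (B3Taylor310LocalRemainder.tdist_triangle z (embIter k (iterBlockOf k z)) z').trans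
      (Nat.add_le_add_left (B3Taylor310LocalRemainder.tdist_triangle (embIter k (iterBlockOf k z)) (embIter k (iterBlockOf k z')) z') _)
  have e1 : P.d * (P.L ^ k - 1) + P.d = P.d * P.L ^ k := by
    rw [Nat.mul_sub, mul_one, Nat.sub_add_cancel (Nat.le_mul_of_pos_right _ hq)]
  have e2 : P.d * P.L ^ k * (Fc.card - 1) + P.d * P.L ^ k = P.d * P.L ^ k * Fc.card := by
    rw [Nat.mul_sub, mul_one, Nat.sub_add_cancel (Nat.le_mul_of_pos_right _ hn)]
  have h5 : P.d * P.L ^ k ≤ P.d * P.L ^ k * Fc.card := Nat.le_mul_of_pos_right _ hn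
  have h4 : P.d * (P.L ^ k - 1) + (P.d * P.L ^ k * (Fc.card - 1) + P.d * (P.L ^ k - 1)) ≤ 2 * P.d * P.L ^ k * Fc.card := by
    have : 2 * P.d * P.L ^ k * Fc.card = P.d * P.L ^ k * Fc.card + P.d * P.L ^ k * Fc.card := by ring
    omega
  omega

/-! ## §3 The footprint letters of the socket -/

open Classical in
/-- **`hℓ` FOR ADMISSIBLE FOOTPRINTS**: the source-`tdist` diameter of the footprint `⋃_{y ∈ Fc} cell y` of a touching-connected family of blocks is `≤ 2d·L^μ·|Fc|` (cast to `ℝ`).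
[cite: Balaban1989LargeFieldII, (1.100) p.390 (bookkeeping)] -/
theorem supDiam_biUnion_cell_le (hμ : μ ≤ P.m + P.K) (Fc : Finset (Site P μ))
    (hc : ((touchingGraph (SiteTouch (P := P) (j := μ))).induce (Fc : Set (Site P μ))).Connected) :
    (((Fc.biUnion (fun y => Finset.univ.filter (fun b : PBond P 0 => iterBlockOf μ b.src = y))).sup fun a =>
        (Fc.biUnion (fun y => Finset.univ.filter (fun b : PBond P 0 => iterBlockOf μ b.src = y))).sup fun a' => a.src.tdist a'.src : ℕ) : ℝ) ≤
      (2 * (P.d : ℝ) * (P.L : ℝ) ^ μ) * (Fc.card : ℝ) := by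
  have hsup : ((Fc.biUnion (fun y => Finset.univ.filter (fun b : PBond P 0 => iterBlockOf μ b.src = y))).sup fun a =>
      (Fc.biUnion (fun y => Finset.univ.filter (fun b : PBond P 0 => iterBlockOf μ b.src = y))).sup fun a' => a.src.tdist a'.src : ℕ) ≤
      2 * P.d * P.L ^ μ * Fc.card := by
    refine Finset.sup_le fun a ha => Finset.sup_le fun a' ha' => ?_
    rw [mem_biUnion_cell_iff] at ha ha'
    exact tdist_le_of_blocks_connected hμ Fc hc ha ha'
  have hcast : (((2 * P.d * P.L ^ μ * Fc.card : ℕ)) : ℝ) = (2 * (P.d : ℝ) * (P.L : ℝ) ^ μ) * (Fc.card : ℝ) := by push_cast; ring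
  rw [← hcast]
  exact_mod_cast hsup

open Classical in
/-- ★ **THE `hℓ` ROW OF THE SOCKET, DISCHARGED**: for ANY admissibility predicate whose footprints are unions of the cells of a touching-connected family of blocks (the shape of
the socket's `hAdm`), the source-diameter length obeys `ℓ X ≤ (2d·L^μ) · size X` with `size X := |blocks of X|`. [cite: Balaban1989LargeFieldII, (1.100) p.390 (bookkeeping)] -/
theorem supDiam_le_of_adm (hd : 0 < P.d) (hμ : μ ≤ P.m + P.K) {Λ : Type*} (Adm : Finset Λ → Finset (PBond P 0) → Prop)
    (hAdm : ∀ Q' X, Adm Q' X → ∃ Fc : Finset (Site P μ),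
      ((touchingGraph (SiteTouch (P := P) (j := μ))).induce (Fc : Set (Site P μ))).Connected ∧
        Fc.biUnion (fun y => Finset.univ.filter (fun b : PBond P 0 => iterBlockOf μ b.src = y)) = X)
    (X : Finset (PBond P 0)) (hX : ∃ Q', Adm Q' X) :
    ((X.sup fun a => X.sup fun a' => a.src.tdist a'.src : ℕ) : ℝ) ≤
      (2 * (P.d : ℝ) * (P.L : ℝ) ^ μ) * ((X.image (fun b : PBond P 0 => iterBlockOf μ b.src)).card : ℝ) := by
  obtain ⟨Q', hQ'⟩ := hX
  obtain ⟨Fc, hc, rfl⟩ := hAdm Q' X hQ'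
  rw [card_image_blk_biUnion_cell hd hμ]
  exact supDiam_biUnion_cell_le hμ Fc hc

/-- **`hdiam`**: the source-diameter length dominates the source distance of any two bonds of a polymer (✓`…PolymerPinAlgebra.cast_dist_le_cast_supDiam`, restated in the
socket's letters). [cite: Balaban1989LargeFieldII, (1.97) p.389 (bookkeeping)] -/
theorem footprint_hdiam (X : Finset (PBond P 0)) (e : PBond P 0) (he : e ∈ X) (e' : PBond P 0) (he' : e' ∈ X) :
    ((e.src.tdist e'.src : ℕ) : ℝ) ≤ ((X.sup fun a => X.sup fun a' => a.src.tdist a'.src : ℕ) : ℝ) :=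
  Summit.QuantumFields.YangMills.Theorems.FluctuationComparisonRegPrIntLPolymerPinAlgebra.cast_dist_le_cast_supDiam
    (fun a a' : PBond P 0 => a.src.tdist a'.src) X he he'

/-- **`h1Δ`**: `1 ≤ 3^d − 1` for `d ≥ 1` (`Δ = 3^d − 1 = 26` for `d = 3`). [cite: Balaban1989LargeFieldII, (1.84) p.386 (bookkeeping)] -/
theorem one_le_three_pow_sub_one (hd : 0 < P.d) : 1 ≤ 3 ^ P.d - 1 := by
  have h : 3 ≤ 3 ^ P.d := by
    calc 3 = 3 ^ 1 := (pow_one 3).symm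
      _ ≤ 3 ^ P.d := Nat.pow_le_pow_right (by norm_num) hd
  omega

open Classical in
/-- ★★ **THE FOOTPRINT GEOMETRY OF THE SOCKET, ALL ROWS AT ONCE** — on any torus of the tree's `Setup` with `d ≥ 1` and any grain `μ ≤ m + K`: with `C := Site P μ` (blocks),
`H := touchingGraph SiteTouch`, `Δ := 3^d − 1`, `cell y := {b | iterBlockOf μ b.src = y}`, `m := 1`, `s₀ := d·L^{dμ}`, `size X := |blocks of X|`, `ℓ X :=` the source-`tdist` diameter,
`ℓ₀ := 2d·L^μ`, the rows `hΔ h1Δ hm h1m hs₀ hℓ0 hdiam` of ✓`…LargeFieldGasKnitAE.canIntBody_of_factorised_histories` hold, and `hℓ` holds for every admissibility predicate of the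
socket's shape (`supDiam_le_of_adm`). [cite: Balaban1989LargeFieldII, (1.84) p.386 and (1.97)-(1.100) pp.389-390 (bookkeeping)] -/
theorem footprint_letters (hd : 0 < P.d) (hμ : μ ≤ P.m + P.K) :
    (∀ y : Site P μ, (touchingGraph (SiteTouch (P := P) (j := μ))).degree y ≤ 3 ^ P.d - 1) ∧ (1 ≤ 3 ^ P.d - 1) ∧
    (∀ e : PBond P 0, (Finset.univ.filter fun y : Site P μ => e ∈ Finset.univ.filter (fun b : PBond P 0 => iterBlockOf μ b.src = y)).card ≤ 1) ∧ (1 ≤ 1) ∧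
    (∀ y : Site P μ, (Finset.univ.filter fun b : PBond P 0 => iterBlockOf μ b.src = y).card ≤ P.d * (P.L ^ P.d) ^ μ) ∧
    (∀ X : Finset (PBond P 0), (0 : ℝ) ≤ ((X.sup fun a => X.sup fun a' => a.src.tdist a'.src : ℕ) : ℝ)) ∧
    (∀ X : Finset (PBond P 0), ∀ e ∈ X, ∀ e' ∈ X,
      ((e.src.tdist e'.src : ℕ) : ℝ) ≤ ((X.sup fun a => X.sup fun a' => a.src.tdist a'.src : ℕ) : ℝ)) := by
  refine ⟨fun y => degree_touchingGraph_siteTouch_le_pred y, one_le_three_pow_sub_one hd, card_filter_mem_cell_le_one, le_rfl,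
    card_cell_le hμ, fun X => Nat.cast_nonneg _, fun X e he e' he' => footprint_hdiam X e he e' he'⟩

end Summit.QuantumFields.YangMills.Theorems.FluctuationComparisonRegPrIntLLargeFieldGasFootprint

end
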